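import Mathlib
import Summits.ValiantsHypothesis.ValiantsHypothesis.Theorems.BarrierLeverPartitionMinorsHitByVPHiddenStatesSymbolic

/-!
# Route BarrierLever — item `PartitionMinorsHitByVP` (stmt-ValiantsHypothesis-19717), line `hidden_states`:
# the exact-support (simplex-product) door READS INTO the symbolic join calculus — cut certificates for simplex designs

Helper file (`--supports stmt-ValiantsHypothesis-19717`; cell valiant-natproofs, rung V4, 𝒟-side door (c), line
`Cruxes/PartitionMinorsHitByVP/Lines/hidden_states.lean` v8, registered stub `stub_simplexPairLower` / by-name node
`SimplexJoin.Stmt.simplexUniversal`; prover seat val-np-p3 gen 13). One bookkeeping `def` (`SimplexJoin.Cut.enc`, the column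
encoding); everything else is proved. Closes NO item.

THE POINT. Every node of the simplex-product lane (`…SimplexJoinNodes`: `Stmt.simplexUniversal`, `Stmt.simplexPairLower`) ends in
`∃ tx, det [∏_{a ∈ u i} (tx p none a + Σ_f ((e k).2 f).elim 0 (tx p (some (f,·)) a))]_{i,k} ≠ 0` for a design
`e : Fin r → Fin m × (Fin D → Option (Fin N))` (column `k` chooses, in piece `p = (e k).1`, one option `(e k).2 f` per slot `f`).
Encoding a column `(p, g)` as the WIDE column `(p, graph g)` — the set of states `(f, j)` with `g f = some j`, read in `Fin (D·N)`
through `finProdFinEquiv` — identifies this matrix ENTRYWISE with the block-additive matrix of the wide join door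
(`tx' p none a + Σ_{q ∈ graph g} tx' p (some q) a`). Hence (`simplexGood_iff_symGood`) the `∃ tx` goodness of a simplex design
on the rows `u` is EXACTLY generic goodness `SymbJoin.symDet u (enc ∘ e) ≠ 0` of val-np-p3 g10's symbolic calculus
(`…HiddenStatesSymbolic`, p585554), and the SYMBOLIC SPLIT THEOREM `SymbJoin.symGood_of_split` (hyperplane cuts with shared
indeterminates, block-triangular specialisation in the domain `ℂ[X]`) certifies simplex designs: `simplexGood_of_split`.
For simplex products the cut constants of ONE slot per piece realise ANY two-colouring of that slot's value set
(`xi_oneSlot`: `β_p = [none is coloured 1]`, `γ_{p,(f_p,j)} = [j is coloured 1] − β_p`, other slots `0`), so a cut splits every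
piece along one slot into two simplex products again (children share the piece count) — the FACTOR-CUT calculus whose
arithmetic (which splits hit the deletion/link sizes of a down-set) is the seat's «box-splitting game» (memo val-np-p3 g13).

WHAT THIS IS NOT: no design is certified here and no node of the line is asserted; item 19717 stays OPEN; nothing on crux 14610
or VP ≠ VNP.
-/

set_option linter.dupNamespace false

namespace Summit.ValiantsHypothesis.ValiantsHypothesis.Theorems.BarrierLever.SimplexJoin.Cut

open Finset Matrix MvPolynomial
open Summit.ValiantsHypothesis.ValiantsHypothesis.Theorems.BarrierLever.HiddenStates

noncomputable section

variable {h m D N r : ℕ}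

/-! ## 1. The column encoding -/

/-- The WIDE encoding of a simplex-product column `(p, g)`: the piece `p` together with the graph of `g`
(the chosen states `(f, j)`, `g f = some j`), read in `Fin (D * N)` through `finProdFinEquiv`. -/
def enc (c : Fin m × (Fin D → Option (Fin N))) : Fin m × Finset (Fin (D * N)) :=
  (c.1, ((Finset.univ : Finset (Fin D × Fin N)).filter fun q => c.2 q.1 = some q.2).map finProdFinEquiv.toEmbedding)

/-- The encoding keeps the piece. -/
@[simp] theorem enc_fst (c : Fin m × (Fin D → Option (Fin N))) : (enc c).1 = c.1 := rfl

/-- Summing over the encoded state set is summing the chosen option of every slot. -/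
theorem sum_enc {M : Type*} [AddCommMonoid M] (c : Fin m × (Fin D → Option (Fin N))) (F : Fin (D * N) → M) :
    ∑ q ∈ (enc c).2, F q = ∑ f : Fin D, (c.2 f).elim 0 fun j => F (finProdFinEquiv (f, j)) := by
  classical
  unfold enc
  rw [Finset.sum_map, Finset.sum_filter, Fintype.sum_prod_type]
  refine Finset.sum_congr rfl fun f _ => ?_
  rcases hg : c.2 f with _ | j₀
  · simp [hg]
  · simp [hg, Finset.sum_ite_eq]

/-- From a simplex table to a wide table (states decoded through `finProdFinEquiv`). -/
def wideTable (tx : Fin m → Option (Fin D × Fin N) → Fin h → ℂ) : Fin m → Option (Fin (D * N)) → Fin h → ℂ :=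
  fun p o a => o.elim (tx p none a) fun q => tx p (some (finProdFinEquiv.symm q)) a

/-- From a wide table to a simplex table. -/
def simplexTable (tw : Fin m → Option (Fin (D * N)) → Fin h → ℂ) : Fin m → Option (Fin D × Fin N) → Fin h → ℂ :=
  fun p o a => o.elim (tw p none a) fun fj => tw p (some (finProdFinEquiv fj)) a

/-- The wide hidden point of the encoded column, at the wide table of `tx`, is the simplex point of the column at `tx`. -/
theorem widePoint_wideTable (tx : Fin m → Option (Fin D × Fin N) → Fin h → ℂ)
    (c : Fin m × (Fin D → Option (Fin N))) (a : Fin h) :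
    wideTable tx (enc c).1 none a + ∑ q ∈ (enc c).2, wideTable tx (enc c).1 (some q) a
      = tx c.1 none a + ∑ f : Fin D, (c.2 f).elim 0 fun j => tx c.1 (some (f, j)) a := by
  rw [sum_enc]
  simp only [wideTable, enc_fst, Option.elim_none, Option.elim_some, Equiv.symm_apply_apply]

/-- The simplex point of a column at the simplex table of `tw` is the wide point of the encoded column at `tw`. -/
theorem simplexPoint_simplexTable (tw : Fin m → Option (Fin (D * N)) → Fin h → ℂ)
    (c : Fin m × (Fin D → Option (Fin N))) (a : Fin h) :
    (simplexTable tw c.1 none a + ∑ f : Fin D, (c.2 f).elim 0 fun j => simplexTable tw c.1 (some (f, j)) a)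
      = tw (enc c).1 none a + ∑ q ∈ (enc c).2, tw (enc c).1 (some q) a := by
  rw [sum_enc]
  simp only [simplexTable, enc_fst, Option.elim_none, Option.elim_some]

/-! ## 2. Goodness of a simplex design = generic goodness of its encoding -/

/-- **Numeric ⇒ generic.** A table making the `u`-side matrix of the simplex design `e` nonsingular makes the encoded
configuration generically good. -/
theorem symGood_of_simplexTable (u : Fin r → Finset (Fin h)) (e : Fin r → Fin m × (Fin D → Option (Fin N)))
    (tx : Fin m → Option (Fin D × Fin N) → Fin h → ℂ)
    (hx : (Matrix.of fun i k : Fin r => ∏ a ∈ u i,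
      (tx (e k).1 none a + ∑ f : Fin D, ((e k).2 f).elim 0 fun j => tx (e k).1 (some (f, j)) a)).det ≠ 0) :
    SymbJoin.symDet u (fun k => enc (e k)) ≠ 0 := by
  refine SymbJoin.symGood_of_table u (fun k => enc (e k)) (wideTable tx) ?_
  have hM : (Matrix.of fun i k : Fin r => ∏ a ∈ u i,
      (wideTable tx (enc (e k)).1 none a + ∑ q ∈ (enc (e k)).2, wideTable tx (enc (e k)).1 (some q) a))
      = Matrix.of fun i k : Fin r => ∏ a ∈ u i,
        (tx (e k).1 none a + ∑ f : Fin D, ((e k).2 f).elim 0 fun j => tx (e k).1 (some (f, j)) a) := by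
    ext i k
    simp only [Matrix.of_apply]
    exact Finset.prod_congr rfl fun a _ => widePoint_wideTable tx (e k) a
  rw [hM]
  exact hx

/-- **Generic ⇒ numeric.** A generically good encoded configuration has a good SIMPLEX table. -/
theorem exists_simplexTable_of_symGood (u : Fin r → Finset (Fin h)) (e : Fin r → Fin m × (Fin D → Option (Fin N)))
    (hG : SymbJoin.symDet u (fun k => enc (e k)) ≠ 0) :
    ∃ tx : Fin m → Option (Fin D × Fin N) → Fin h → ℂ,
      (Matrix.of fun i k : Fin r => ∏ a ∈ u i,
        (tx (e k).1 none a + ∑ f : Fin D, ((e k).2 f).elim 0 fun j => tx (e k).1 (some (f, j)) a)).det ≠ 0 := by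
  obtain ⟨tw, htw⟩ := SymbJoin.exists_table_of_symGood u (fun k => enc (e k)) hG
  refine ⟨simplexTable tw, ?_⟩
  have hM : (Matrix.of fun i k : Fin r => ∏ a ∈ u i,
      (simplexTable tw (e k).1 none a + ∑ f : Fin D, ((e k).2 f).elim 0 fun j => simplexTable tw (e k).1 (some (f, j)) a))
      = Matrix.of fun i k : Fin r => ∏ a ∈ u i,
        (tw (enc (e k)).1 none a + ∑ q ∈ (enc (e k)).2, tw (enc (e k)).1 (some q) a) := by
    ext i k
    simp only [Matrix.of_apply]
    exact Finset.prod_congr rfl fun a _ => simplexPoint_simplexTable tw (e k) a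
  rw [hM]
  exact htw

/-- **Goodness of a simplex design on the rows `u` is generic goodness of its wide encoding.** -/
theorem simplexGood_iff_symGood (u : Fin r → Finset (Fin h)) (e : Fin r → Fin m × (Fin D → Option (Fin N))) :
    (∃ tx : Fin m → Option (Fin D × Fin N) → Fin h → ℂ,
      (Matrix.of fun i k : Fin r => ∏ a ∈ u i,
        (tx (e k).1 none a + ∑ f : Fin D, ((e k).2 f).elim 0 fun j => tx (e k).1 (some (f, j)) a)).det ≠ 0)
      ↔ SymbJoin.symDet u (fun k => enc (e k)) ≠ 0 :=
  ⟨fun ⟨tx, hx⟩ => symGood_of_simplexTable u e tx hx, exists_simplexTable_of_symGood u e⟩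

/-! ## 3. Cuts for simplex designs -/

/-- **The symbolic split theorem for simplex designs** (`SymbJoin.symGood_of_split` read through the encoding): fix a coordinate
`x` and wide cut constants `β, γ`; if the rows avoiding `x` against the columns with cut value `0`, and the rows containing `x`
(with `x` erased) against the columns with nonzero cut value, are generically good simplex configurations, so is the whole. -/
theorem simplexGood_of_split {r₀ r₁ : ℕ} (u : Fin r → Finset (Fin h)) (e : Fin r → Fin m × (Fin D → Option (Fin N)))
    (x : Fin h) (β : Fin m → ℂ) (γ : Fin m → Fin (D * N) → ℂ) (er ec : Fin r₀ ⊕ Fin r₁ ≃ Fin r)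
    (hrow0 : ∀ j, x ∉ u (er (Sum.inl j))) (hrow1 : ∀ j, x ∈ u (er (Sum.inr j)))
    (hcol0 : ∀ j, SymbJoin.xi (fun k => enc (e k)) β γ (ec (Sum.inl j)) = 0)
    (hcol1 : ∀ j, SymbJoin.xi (fun k => enc (e k)) β γ (ec (Sum.inr j)) ≠ 0)
    (h0 : SymbJoin.symDet (fun j : Fin r₀ => u (er (Sum.inl j))) (fun j => enc (e (ec (Sum.inl j)))) ≠ 0)
    (h1 : SymbJoin.symDet (fun j : Fin r₁ => (u (er (Sum.inr j))).erase x) (fun j => enc (e (ec (Sum.inr j)))) ≠ 0) :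
    SymbJoin.symDet u (fun k => enc (e k)) ≠ 0 :=
  SymbJoin.symGood_of_split u (fun k => enc (e k)) x β γ er ec hrow0 hrow1 hcol0 hcol1 h0 h1

/-- **One-slot cut constants.** For a piece `p`, a slot `f₀` and a colouring `side : Option (Fin N) → Bool` of the values of that
slot, the cut constants `β_p = [side none]`, `γ_{p,(f₀,j)} = [side (some j)] − [side none]`, `γ_{p,(f,j)} = 0` (`f ≠ f₀`) give every
column `(p, g)` of the piece the cut value `[side (g f₀)]`: the columns whose slot-`f₀` value is coloured `false` are exactly the
cut-value-`0` columns. (So a cut splits a simplex-product piece along ONE slot into two simplex products, either part on either side.) -/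
theorem xi_oneSlot (e : Fin r → Fin m × (Fin D → Option (Fin N))) (β : Fin m → ℂ) (γ : Fin m → Fin (D * N) → ℂ)
    (k : Fin r) (f₀ : Fin D) (side : Option (Fin N) → Bool)
    (hβ : β (e k).1 = if side none then 1 else 0)
    (hγ₀ : ∀ j : Fin N, γ (e k).1 (finProdFinEquiv (f₀, j)) = (if side (some j) then 1 else 0) - (if side none then 1 else 0))
    (hγ : ∀ (f : Fin D) (j : Fin N), f ≠ f₀ → γ (e k).1 (finProdFinEquiv (f, j)) = 0) :
    SymbJoin.xi (fun k => enc (e k)) β γ k = if side ((e k).2 f₀) then 1 else 0 := by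
  classical
  unfold SymbJoin.xi
  rw [sum_enc, enc_fst, hβ]
  rw [← Finset.add_sum_erase Finset.univ _ (Finset.mem_univ f₀)]
  have hrest : ∑ f ∈ (Finset.univ : Finset (Fin D)).erase f₀,
      ((e k).2 f).elim (0 : ℂ) (fun j => γ (e k).1 (finProdFinEquiv (f, j))) = 0 := by
    refine Finset.sum_eq_zero fun f hf => ?_
    have hne : f ≠ f₀ := Finset.ne_of_mem_erase hf
    rcases (e k).2 f with _ | j
    · rfl
    · simp [hγ f j hne]
  rw [hrest, add_zero]
  rcases hg : (e k).2 f₀ with _ | j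
  · simp
  · simp only [Option.elim_some, hγ₀ j]
    ring

/-- The cut value of a column of a piece sent WHOLE to one side: `β_p = [side]`, `γ_p = 0` gives cut value `[side]`. -/
theorem xi_whole (e : Fin r → Fin m × (Fin D → Option (Fin N))) (β : Fin m → ℂ) (γ : Fin m → Fin (D * N) → ℂ)
    (k : Fin r) (side : Bool) (hβ : β (e k).1 = if side then 1 else 0) (hγ : ∀ q, γ (e k).1 q = 0) :
    SymbJoin.xi (fun k => enc (e k)) β γ k = if side then 1 else 0 := by
  unfold SymbJoin.xi
  rw [enc_fst, hβ, Finset.sum_eq_zero fun q _ => hγ q, add_zero]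

/-! ## 4. Base cases -/

/-- A single column is generically good for any single row (table: base `1`, states `0`; the entry is `1`). -/
theorem symGood_one (u : Fin 1 → Finset (Fin h)) (e : Fin 1 → Fin m × (Fin D → Option (Fin N))) :
    SymbJoin.symDet u (fun k => enc (e k)) ≠ 0 := by
  refine SymbJoin.symGood_of_table u (fun k => enc (e k)) (fun _ o _ => o.elim 1 fun _ => 0) ?_
  rw [Matrix.det_fin_one, Matrix.of_apply]
  refine Finset.prod_ne_zero_iff.mpr fun a _ => ?_
  simp

/-- The empty configuration is generically good. -/
theorem symGood_zero (u : Fin 0 → Finset (Fin h)) (e : Fin 0 → Fin m × (Fin D → Option (Fin N))) :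
    SymbJoin.symDet u (fun k => enc (e k)) ≠ 0 := by
  unfold SymbJoin.symDet
  rw [Matrix.det_isEmpty]
  exact one_ne_zero

end

end Summit.ValiantsHypothesis.ValiantsHypothesis.Theorems.BarrierLever.SimplexJoin.Cut
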